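import Literature.Analysis.FluidPDE.DuchonRobert
import Literature.Analysis.FluidPDE.DissipationAnomalyProofs
import Literature.Analysis.FunctionSpaces.SpaceTimeWeakCompactness
import Literature.Analysis.FunctionSpaces.TorusSpaceTime
import HarnessLib

/-!
# Vanishing-viscosity limit objects (turb.S20): discharge of `tendstoWeakStar_compact`

Analysis/FluidPDE proof file; sibling of `Literature.Analysis.FluidPDE.DuchonRobert` (kept out of
that much-imported statement file so as not to load the proof imports `DissipationAnomalyProofs` /
`SpaceTimeWeakCompactness` onto it; same pattern as `DuchonRobertWeakEulerLimit`). It PROVES the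
named fact
`Literature.Analysis.FluidPDE.tendstoWeakStar_compact` (turb.S20; DiPerna–Majda 1987, §1 Theorem
and §5; Buckmaster–Vicol 2019, §8): unforced Leray–Hopf solutions `u_m` on `T^d × [0,T)` with
viscosities `ν_m > 0`, `ν_m → 0` and data of uniformly bounded kinetic energy have, along a
subsequence, a weak-* limit `u` in `L^∞(0,T; L²)` (`Torus.TendstoWeakStar`) and a limiting
dissipation measure `D` (`Torus.IsDissipationMeasureOf`).

We follow the printed proof (DiPerna–Majda 1987, §5, pp. 687–688, proof of the §1 Theorem,
p. 668: "let `v^ε` be any (Leray-Hopf) weak solution of the Navier-Stokes equations (1.2) with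
initial data `v₀`. Then as `ε` vanishes a subsequence has a limit which defines a measure-valued
solution"), keeping only its compactness content, which is what the fact vendors:

1. p. 687: "there is at least one Leray-Hopf weak solution `v^ε(x,t)` … satisfying the kinetic
   energy inequality `max_{0≤t<+∞} ∫|v^ε(x,t)|² dx ≤ ∫|v₀(x)|² dx` (5.2). Thus, in the high Reynolds
   number limit, `v^ε` satisfies the weak stability estimate." —
   `Torus.IsLerayHopfOn.lintegral_enorm_sq_le_ofReal`: for `ν ≥ 0`, `f = 0`,
   `∫⁻ ‖u(t)‖ₑ² = 2E(u(t)) ≤ 2E(u₀)` for every `t ∈ [0,T]` (field `energy_ineq_zero`, dissipation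
   dropped; Leray 1934, (5.2));
2. p. 672, Theorem 1: "If `{v^ε}` is an arbitrary family of functions whose `L²` norm on a set
   `Ω ⊂ ℝⁿ × ℝ` is uniformly bounded, then `{v^ε}` contains a sequence with the following
   properties …" — of which the fact keeps the weak(-*) limit `v^ε ⇀ v` (Banach–Alaoglu; Brezis
   2011, Thm. 3.18 / Cor. 3.30): `FunctionSpaces.Torus.exists_strictMono_weakLimit_inner_of_lintegral_sq_le`,
   the Hilbert-space-valued twin of the tree's scalar
   `FunctionSpaces.Torus.exists_strictMono_weakLimit_of_lintegral_sq_le` (`SpaceTimeWeakCompactness`):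
   the fields form a bounded sequence in the separable Hilbert space `L²((0,T) × T^d; F)`, which has
   a weakly convergent subsequence (`FunctionSpaces.exists_strictMono_tendsto_inner_of_norm_le`);
   read as a function, the weak limit is the field `u`, and the pairings are the iterated integrals
   `∫₀ᵀ∫ ⟪u_m, G⟫` (Fubini). Smooth space–time test fields are bounded on `[0,T] × T^d`, hence
   square integrable (`IsSpaceTimeTest.aestronglyMeasurable_and_lintegral_lt_top`), so this is
   `Torus.TendstoWeakStar` (`Torus.exists_strictMono_tendstoWeakStar_of_isLerayHopfOn`);
3. the limiting dissipation measure `ν_m|∇u_m|² dx dt ⇀ D` (Buckmaster–Vicol 2019, §8; masses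
   `≤ ½‖u₀^m‖² ≤ C` by the energy inequality) — already proved in the tree:
   `Torus.TendstoWeakStar.exists_subseq_isDissipationMeasureOf_holds` (`DissipationAnomalyProofs`;
   Prokhorov on the compact `[0,T] × T^d`), applied along the subsequence of step 2 (it keeps the
   weak-* limit, `TendstoWeakStar.comp`).

The assembly is `tendstoWeakStar_compact_holds`. The hypothesis `ν_m → 0` of the fact is not used
(compactness only needs `ν_m ≥ 0` and the energy bound), exactly as in the source, where it only
serves — through the identity (5.3), p. 688 — to identify the limit as a measure-valued Euler
solution (Prop. 5.1), the part of the §1 Theorem that is deliberately **not** formalised (see the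
docstring of `tendstoWeakStar_compact`).

## Mathlib / tree search

Mathlib (this pin): `MeasureTheory.L2.innerProductSpace` (`Lp F 2 μ` is a Hilbert space),
`MeasureTheory.Lp.SecondCountableTopology` (separable for separable `μ` and `F`; the separability
of `(dt⌊(0,T)) ⊗ dx` is `MeasureTheory.isSeparable_of_sigmaFinite`), `L2.inner_def`,
`L2.integrable_inner`, `integral_prod`; no sequential Banach–Alaoglu (the tree's
`SpaceTimeWeakCompactness` / `DiagonalWeakLimits` supply it). Tree: the scalar weak-* compactness
`Torus.exists_strictMono_weakLimit_of_lintegral_sq_le` (not applicable componentwise without an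
iterated extraction, and the Hilbert-space argument is verbatim the same for `F`-valued fields).

## References

* R. J. DiPerna, A. J. Majda, *Oscillations and concentrations in weak solutions of the
  incompressible fluid equations*, Comm. Math. Phys. 108 (1987) 667–689, §1 Theorem, (1.4)–(1.5),
  §5 (5.2)–(5.3), Prop. 5.1. [DiPernaMajda1987]
* T. Buckmaster, V. Vicol, *Convex integration and phenomenologies in turbulence*, EMS Surv.
  Math. Sci. 6 (2019), §8. [BuckmasterVicol2019]
* H. Brezis, *Functional Analysis, Sobolev Spaces and Partial Differential Equations* (2011),
  Thm. 3.18, Cor. 3.30. [Brezis2011]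
* J. Leray, Acta Math. 63 (1934), (5.2). [Leray1934]
-/

noncomputable section

open MeasureTheory Filter Topology Set Function TopologicalSpace
open scoped ENNReal NNReal InnerProductSpace RealInnerProductSpace

/-! ## Weak sequential compactness in `L²((0,T) × T^d; F)` for Hilbert-space-valued fields -/

namespace Literature.Analysis.FunctionSpaces.Torus

variable {d : Type*} [Fintype d]
variable {F : Type*} [NormedAddCommGroup F]

/-- A space–time field with values in a normed group, with measurable uncurrying and finite
`∫⁻₍₀,T₎∫⁻ ‖θ‖²`, is in `L²((vol|_(0,T)) ⊗ vol; F)`, with `‖θ‖_{L²}² = ∫⁻₍₀,T₎∫⁻ ‖θ‖²` (Tonelli;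
the scalar case is `Torus.memLp_two_uncurry`). [folklore] -/
theorem memLp_two_uncurry_of_lintegral_lt_top {T : ℝ} {θ : ℝ → UnitAddTorus d → F}
    (hθ : AEStronglyMeasurable (uncurry θ) ((volume.restrict (Ioo 0 T)).prod volume))
    (hfin : ∫⁻ t in Ioo 0 T, ∫⁻ x, ‖θ t x‖ₑ ^ 2 < ∞) :
    MemLp (uncurry θ) 2 ((volume.restrict (Ioo 0 T)).prod volume) ∧
      eLpNorm (uncurry θ) 2 ((volume.restrict (Ioo 0 T)).prod volume) ^ 2 =
        ∫⁻ t in Ioo 0 T, ∫⁻ x, ‖θ t x‖ₑ ^ 2 := by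
  have hsq : eLpNorm (uncurry θ) 2 ((volume.restrict (Ioo 0 T)).prod volume) ^ 2 =
      ∫⁻ t in Ioo 0 T, ∫⁻ x, ‖θ t x‖ₑ ^ 2 := by
    rw [eLpNorm_two_pow_two_eq_lintegral, lintegral_prod _ (hθ.enorm.pow_const 2)]
    rfl
  refine ⟨⟨hθ, ?_⟩, hsq⟩
  rw [eLpNorm_two_eq_pow_two_rpow_half, hsq]
  exact ENNReal.rpow_lt_top_of_nonneg (by norm_num) hfin.ne

variable [InnerProductSpace ℝ F]

/-- The `L²((vol|_(0,T)) ⊗ vol; F)` pairing of two space–time fields is the iterated integral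
`∫_{(0,T)} ∫ ⟪θ, G⟫` (Fubini; the inner product of two `L²` functions is integrable,
`L2.integrable_inner`; the scalar case is `Torus.inner_toLp_uncurry_eq`). [folklore] -/
theorem inner_toLp_uncurry_eq_integral_inner {T : ℝ} {θ G : ℝ → UnitAddTorus d → F}
    (hθ : MemLp (uncurry θ) 2 ((volume.restrict (Ioo 0 T)).prod volume))
    (hG : MemLp (uncurry G) 2 ((volume.restrict (Ioo 0 T)).prod volume)) :
    ⟪hθ.toLp (uncurry θ), hG.toLp (uncurry G)⟫ = ∫ t in Ioo 0 T, ∫ x, ⟪θ t x, G t x⟫ := by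
  have hint : Integrable (fun p : ℝ × UnitAddTorus d => ⟪θ p.1 p.2, G p.1 p.2⟫)
      ((volume.restrict (Ioo 0 T)).prod volume) := by
    refine (L2.integrable_inner (𝕜 := ℝ) (hθ.toLp (uncurry θ)) (hG.toLp (uncurry G))).congr ?_
    filter_upwards [hθ.coeFn_toLp, hG.coeFn_toLp] with p hp hq
    rw [hp, hq]
    rfl
  rw [L2.inner_def, ← integral_prod _ hint]
  refine integral_congr_ae ?_
  filter_upwards [hθ.coeFn_toLp, hG.coeFn_toLp] with p hp hq
  rw [hp, hq]
  rfl

variable [CompleteSpace F] [SeparableSpace F]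

/-- **Weak sequential compactness of `L^∞_t L²_x`-bounded sequences of Hilbert-space-valued
space–time fields** (Banach–Alaoglu for the separable predual `L¹(0,T; L²)`, Brezis 2011,
Cor. 3.30 / Thm. 3.18; the form used by DiPerna–Majda 1987, §1, (1.4)–(1.5), "by passing to a
subsequence, `u^ε ⇀ u` weak-* in `L^∞(0,T; L²)`"). Let `θ j : ℝ → T^d → F` (`F` a separable real
Hilbert space, e.g. `ℝ^d`) have a.e. strongly measurable space–time lifts on `(0,T) × ℝ^d` and
`∫ ‖θ j (t)‖² ≤ C` for a.e. `t ∈ (0,T)`, uniformly in `j`. Then there are a subsequence `φ` and a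
field `W` — with measurable lift and `∫₀ᵀ∫ ‖W‖² < ∞` — such that `∫₀ᵀ∫ ⟪θ (φ j), G⟫ → ∫₀ᵀ∫ ⟪W, G⟫`
for every space–time `G` with measurable lift and `∫₀ᵀ∫ ‖G‖² < ∞` (weak convergence in
`L²((0,T) × T^d; F)`; on bounded subsets of `L^∞_t L²_x` this is weak-* convergence against the
dense subspace `L²_{t,x} ⊆ L¹_t L²_x`). Proof: the `uncurry (θ j)` form a bounded sequence in the
separable Hilbert space `L²((vol|_(0,T)) ⊗ vol; F)`
(`FunctionSpaces.exists_strictMono_tendsto_inner_of_norm_le`); the weak limit, read as a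
function, is `W`; pairings are iterated integrals (`inner_toLp_uncurry_eq_integral_inner`).
Hilbert-space-valued twin of `Torus.exists_strictMono_weakLimit_of_lintegral_sq_le` (same file
lineage, `SpaceTimeWeakCompactness`), without the slicewise bound on the limit. [cite: Brezis2011, Thm. 3.18] -/
theorem exists_strictMono_weakLimit_inner_of_lintegral_sq_le {T : ℝ} {C : ℝ≥0}
    {θ : ℕ → ℝ → UnitAddTorus d → F}
    (hm : ∀ j, AEStronglyMeasurable (stLift (θ j)) (volume.restrict (Ioo 0 T ×ˢ univ)))
    (hb : ∀ j, ∀ᵐ t ∂(volume.restrict (Ioo 0 T)), ∫⁻ x, ‖θ j t x‖ₑ ^ 2 ≤ C) :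
    ∃ φ : ℕ → ℕ, StrictMono φ ∧ ∃ W : ℝ → UnitAddTorus d → F,
      AEStronglyMeasurable (stLift W) (volume.restrict (Ioo 0 T ×ˢ univ)) ∧
      (∫⁻ t in Ioo 0 T, ∫⁻ x, ‖W t x‖ₑ ^ 2 < ∞) ∧
      ∀ G : ℝ → UnitAddTorus d → F,
        AEStronglyMeasurable (stLift G) (volume.restrict (Ioo 0 T ×ˢ univ)) →
        ∫⁻ t in Ioo 0 T, ∫⁻ x, ‖G t x‖ₑ ^ 2 < ∞ →
        Tendsto (fun j => ∫ t in Ioo 0 T, ∫ x, ⟪θ (φ j) t x, G t x⟫) atTop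
          (𝓝 (∫ t in Ioo 0 T, ∫ x, ⟪W t x, G t x⟫)) := by
  haveI : Fact ((2 : ℝ≥0∞) ≠ ∞) := ⟨ENNReal.ofNat_ne_top⟩
  set μ : Measure (ℝ × UnitAddTorus d) :=
    ((volume : Measure ℝ).restrict (Ioo 0 T)).prod (volume : Measure (UnitAddTorus d)) with hμ
  haveI : IsSeparable μ := isSeparable_of_sigmaFinite μ
  haveI : SeparableSpace (Lp F 2 μ) := inferInstance
  -- the fields as a bounded sequence in `L²(μ; F)`
  have hvol : volume (Ioo (0 : ℝ) T) < ∞ := measure_Ioo_lt_top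
  set B : ℝ≥0∞ := C * volume (Ioo (0 : ℝ) T) with hB
  have hBfin : B < ∞ := ENNReal.mul_lt_top ENNReal.coe_lt_top hvol
  have hθm : ∀ j, AEStronglyMeasurable (uncurry (θ j)) μ := fun j =>
    aestronglyMeasurable_uncurry_of_stLift_prod (hm j)
  have hθ2 : ∀ j, ∫⁻ t in Ioo 0 T, ∫⁻ x, ‖θ j t x‖ₑ ^ 2 ≤ B := fun j =>
    calc ∫⁻ t in Ioo 0 T, ∫⁻ x, ‖θ j t x‖ₑ ^ 2 ≤ ∫⁻ _ in Ioo (0 : ℝ) T, (C : ℝ≥0∞) :=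
          lintegral_mono_ae (hb j)
      _ = B := by rw [lintegral_const, Measure.restrict_apply_univ]
  have hθL : ∀ j, MemLp (uncurry (θ j)) 2 μ ∧
      eLpNorm (uncurry (θ j)) 2 μ ^ 2 = ∫⁻ t in Ioo 0 T, ∫⁻ x, ‖θ j t x‖ₑ ^ 2 := fun j =>
    memLp_two_uncurry_of_lintegral_lt_top (hθm j) ((hθ2 j).trans_lt hBfin)
  set M : ℝ := (B ^ (1 / 2 : ℝ)).toReal with hM
  set v : ℕ → Lp F 2 μ := fun j => (hθL j).1.toLp (uncurry (θ j)) with hv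
  have hvM : ∀ j, ‖v j‖ ≤ M := by
    intro j
    rw [hv, Lp.norm_toLp, hM]
    refine ENNReal.toReal_mono (ENNReal.rpow_ne_top_of_nonneg (by norm_num) hBfin.ne) ?_
    rw [eLpNorm_two_eq_pow_two_rpow_half, (hθL j).2]
    exact ENNReal.rpow_le_rpow (hθ2 j) (by norm_num)
  -- weak limit in the separable Hilbert space `L²(μ; F)`
  obtain ⟨φ, hφ, w, -, hw⟩ := exists_strictMono_tendsto_inner_of_norm_le hvM
  -- the limit as a field
  set W : ℝ → UnitAddTorus d → F := fun t x => (w : ℝ × UnitAddTorus d → F) (t, x) with hWdef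
  have hWunc : uncurry W = (w : ℝ × UnitAddTorus d → F) := rfl
  have hWm : AEStronglyMeasurable (uncurry W) μ := hWunc ▸ (Lp.aestronglyMeasurable w)
  have hWL : MemLp (uncurry W) 2 μ := hWunc ▸ Lp.memLp w
  have hWto : hWL.toLp (uncurry W) = w := Lp.toLp_coeFn w (Lp.memLp w)
  have hW2 : ∫⁻ t in Ioo 0 T, ∫⁻ x, ‖W t x‖ₑ ^ 2 < ∞ := by
    have h1 : ∫⁻ t in Ioo 0 T, ∫⁻ x, ‖W t x‖ₑ ^ 2 = eLpNorm (uncurry W) 2 μ ^ 2 := by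
      rw [eLpNorm_two_pow_two_eq_lintegral,
        lintegral_prod _ (hWm.enorm.pow_const 2)]
      rfl
    rw [h1]
    exact lt_top_iff_ne_top.2 (ENNReal.pow_ne_top hWL.eLpNorm_ne_top)
  -- pairings are iterated integrals
  have hpair : ∀ G : ℝ → UnitAddTorus d → F, ∀ hG : MemLp (uncurry G) 2 μ,
      Tendsto (fun j => ∫ t in Ioo 0 T, ∫ x, ⟪θ (φ j) t x, G t x⟫) atTop
        (𝓝 (∫ t in Ioo 0 T, ∫ x, ⟪W t x, G t x⟫)) := by
    intro G hG
    have h := hw (hG.toLp (uncurry G))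
    have h1 : ∀ j, ⟪v (φ j), hG.toLp (uncurry G)⟫ = ∫ t in Ioo 0 T, ∫ x, ⟪θ (φ j) t x, G t x⟫ :=
      fun j => inner_toLp_uncurry_eq_integral_inner (hθL (φ j)).1 hG
    have h2 : ⟪w, hG.toLp (uncurry G)⟫ = ∫ t in Ioo 0 T, ∫ x, ⟪W t x, G t x⟫ := by
      rw [← hWto]
      exact inner_toLp_uncurry_eq_integral_inner hWL hG
    simp_rw [h1, h2] at h
    exact h
  exact ⟨φ, hφ, W, aestronglyMeasurable_stLift_of_uncurry (S := Ioo 0 T) hWm, hW2,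
    fun G hGm hG2 => hpair G
      (memLp_two_uncurry_of_lintegral_lt_top (aestronglyMeasurable_uncurry_of_stLift_prod hGm) hG2).1⟩

omit [InnerProductSpace ℝ F] [CompleteSpace F] [SeparableSpace F] in
/-- **Smooth space–time test fields are square integrable on `(0,T) × T^d`**: a space–time test
field (`IsSpaceTimeTest`, jointly `C^∞` lift) has an a.e. strongly measurable lift on
`(0,T) × ℝ^d` and `∫₀ᵀ∫ ‖ψ‖² < ∞` — it is bounded on the compact `[0,T] × T^d`
(`IsSmoothSpaceTimeOn.exists_norm_le_of_isCompact`) and the torus has volume one. This is how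
test fields are fed to weak `L²_{t,x}` limits ("these are dense in `L¹(0,T; L²)`", docstring of
`Torus.TendstoWeakStar`). [folklore] -/
theorem IsSpaceTimeTest.aestronglyMeasurable_and_lintegral_lt_top [NormedSpace ℝ F] {T : ℝ}
    {ψ : ℝ → UnitAddTorus d → F} (hψ : IsSpaceTimeTest T ψ) :
    AEStronglyMeasurable (stLift ψ) (volume.restrict (Ioo 0 T ×ˢ univ)) ∧
      ∫⁻ t in Ioo 0 T, ∫⁻ x, ‖ψ t x‖ₑ ^ 2 < ∞ := by
  have hs : IsSmoothSpaceTimeOn univ ψ := hψ.isSmoothSpaceTimeOn univ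
  obtain ⟨C, hC⟩ := hs.exists_norm_le_of_isCompact isCompact_Icc (subset_univ (Icc 0 T))
  refine ⟨hs.aestronglyMeasurable_stLift measurableSet_Ioo (subset_univ _), ?_⟩
  have hpt : ∀ t ∈ Ioo 0 T, ∫⁻ x, ‖ψ t x‖ₑ ^ 2 ≤ ENNReal.ofReal C ^ 2 := by
    intro t ht
    calc ∫⁻ x, ‖ψ t x‖ₑ ^ 2 ≤ ∫⁻ _ : UnitAddTorus d, ENNReal.ofReal C ^ 2 := by
          refine lintegral_mono fun x => ?_
          have hx : ‖ψ t x‖ₑ ≤ ENNReal.ofReal C := by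
            rw [← ofReal_norm]
            exact ENNReal.ofReal_le_ofReal (hC t (Ioo_subset_Icc_self ht) x)
          gcongr
      _ = ENNReal.ofReal C ^ 2 := by rw [lintegral_const, measure_univ, mul_one]
  calc ∫⁻ t in Ioo 0 T, ∫⁻ x, ‖ψ t x‖ₑ ^ 2 ≤ ∫⁻ _ in Ioo 0 T, ENNReal.ofReal C ^ 2 :=
        setLIntegral_mono' measurableSet_Ioo hpt
    _ < ∞ := by
        rw [setLIntegral_const]
        exact ENNReal.mul_lt_top (lt_top_iff_ne_top.2 (ENNReal.pow_ne_top ENNReal.ofReal_ne_top))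
          measure_Ioo_lt_top

end Literature.Analysis.FunctionSpaces.Torus

/-! ## Leray–Hopf sequences: the uniform energy bound and weak-* compactness -/

namespace Literature.Analysis.FluidPDE.Torus

variable {d : Type*} [Fintype d]

/-- For an `L²` field on the torus the extended energy is `2E`:
`∫⁻ ‖w‖ₑ² = ofReal (2 · ½∫‖w‖²)` (`ofReal_integral_eq_lintegral_ofReal` for the integrable
`‖w‖²`). [folklore] -/
theorem lintegral_enorm_sq_eq_ofReal_two_mul_kineticEnergy
    {w : UnitAddTorus d → EuclideanSpace ℝ d} (hw : MemLp w 2 volume) :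
    ∫⁻ x, ‖w x‖ₑ ^ 2 = ENNReal.ofReal (2 * FunctionSpaces.Torus.kineticEnergy w) := by
  have hint : Integrable (fun x => ‖w x‖ ^ 2) volume := hw.integrable_norm_pow two_ne_zero
  rw [FunctionSpaces.Torus.kineticEnergy, ← mul_assoc, mul_inv_cancel₀ two_ne_zero, one_mul,
    ofReal_integral_eq_lintegral_ofReal hint (Eventually.of_forall fun _ => sq_nonneg _)]
  refine lintegral_congr fun x => ?_
  rw [← ofReal_norm, ENNReal.ofReal_pow (norm_nonneg _)]

variable [DecidableEq d]

/-- **Uniform energy bound of unforced Leray–Hopf solutions** (Leray 1934, (5.2); DiPerna–Majda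
1987, §5, (5.2), p. 687: "the kinetic energy inequality `max_{0≤t<+∞} ∫|v^ε(x,t)|² dx ≤ ∫|v₀(x)|² dx`
… Thus … `v^ε` satisfies the weak stability estimate"): for `ν ≥ 0` and an unforced Leray–Hopf
solution `u` on `T^d × [0,T)` with datum `u₀`,
`∫⁻ ‖u(t)‖ₑ² ≤ ofReal (2E(u₀))` for every `t ∈ [0,T]` — the energy inequality from `s = 0`
(field `energy_ineq_zero`) with the dissipation dropped, transported to lower Lebesgue integrals
through `lintegral_enorm_sq_eq_ofReal_two_mul_kineticEnergy` (every slice is `L²`, field `memLp`).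
No integrability of `u₀` is needed (a non-`L²` datum has junk energy `0`, and the inequality then
forces `u(t) = 0` a.e.). [cite: Leray1934, (5.2)] -/
theorem IsLerayHopfOn.lintegral_enorm_sq_le_ofReal {T ν : ℝ} (hν : 0 ≤ ν)
    {u₀ : UnitAddTorus d → EuclideanSpace ℝ d} {u : ℝ → UnitAddTorus d → EuclideanSpace ℝ d}
    (h : IsLerayHopfOn T ν 0 u₀ u) {t : ℝ} (ht : t ∈ Icc 0 T) :
    ∫⁻ x, ‖u t x‖ₑ ^ 2 ≤ ENNReal.ofReal (2 * FunctionSpaces.Torus.kineticEnergy u₀) := by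
  have hle := h.energy_ineq_zero t ht
  simp only [Pi.zero_apply, inner_zero_left, integral_zero, intervalIntegral.integral_zero,
    add_zero] at hle
  have hkin : FunctionSpaces.Torus.kineticEnergy (u t) ≤ FunctionSpaces.Torus.kineticEnergy u₀ :=
    le_trans (le_add_of_nonneg_right (mul_nonneg hν ENNReal.toReal_nonneg)) hle
  rw [lintegral_enorm_sq_eq_ofReal_two_mul_kineticEnergy (h.memLp t ht)]
  exact ENNReal.ofReal_le_ofReal (by linarith)

/-- **Weak-* compactness of vanishing-viscosity Leray–Hopf sequences** (DiPerna–Majda 1987, §1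
Theorem, p. 668, with Theorem 1, p. 672 — "If `{v^ε}` is an arbitrary family of functions whose `L²`
norm … is uniformly bounded, then `{v^ε}` contains a sequence …" — and §5, (5.2), p. 687;
Buckmaster–Vicol 2019, §8): unforced Leray–Hopf solutions `u_m` on `T^d × [0,T)` with viscosities
`ν_m ≥ 0` and data of uniformly bounded kinetic energy `E(u₀^m) ≤ C` are bounded in `L^∞(0,T; L²)`
by `2C` (`IsLerayHopfOn.lintegral_enorm_sq_le_ofReal`), hence along a subsequence converge weak-*
(`Torus.TendstoWeakStar`) to a field `u` with measurable space–time lift and `∫₀ᵀ∫ ‖u‖² < ∞`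
(`FunctionSpaces.Torus.exists_strictMono_weakLimit_inner_of_lintegral_sq_le`, test fields being
square integrable, `IsSpaceTimeTest.aestronglyMeasurable_and_lintegral_lt_top`).
[cite: DiPernaMajda1987, §1 Theorem (p. 668) and §5 (5.2) (p. 687)] -/
theorem exists_strictMono_tendstoWeakStar_of_isLerayHopfOn {T : ℝ} {νseq : ℕ → ℝ}
    {useq : ℕ → ℝ → UnitAddTorus d → EuclideanSpace ℝ d}
    {u₀seq : ℕ → UnitAddTorus d → EuclideanSpace ℝ d}
    (hν : ∀ m, 0 ≤ νseq m) (hLH : ∀ m, IsLerayHopfOn T (νseq m) 0 (u₀seq m) (useq m))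
    (hE : ∃ C : ℝ, ∀ m, FunctionSpaces.Torus.kineticEnergy (u₀seq m) ≤ C) :
    ∃ φ : ℕ → ℕ, StrictMono φ ∧ ∃ u : ℝ → UnitAddTorus d → EuclideanSpace ℝ d,
      AEStronglyMeasurable (FunctionSpaces.Torus.stLift u) (volume.restrict (Ioo 0 T ×ˢ univ)) ∧
      (∫⁻ t in Ioo 0 T, ∫⁻ x, ‖u t x‖ₑ ^ 2 < ∞) ∧
      TendstoWeakStar (useq ∘ φ) u T := by
  obtain ⟨C, hC⟩ := hE
  -- the uniform `L^∞_t L²_x` bound from the energy inequality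
  have hb : ∀ m, ∀ᵐ t ∂(volume.restrict (Ioo 0 T)),
      ∫⁻ x, ‖useq m t x‖ₑ ^ 2 ≤ ((2 * C).toNNReal : ℝ≥0) := by
    intro m
    filter_upwards [ae_restrict_mem measurableSet_Ioo] with t ht
    calc ∫⁻ x, ‖useq m t x‖ₑ ^ 2
        ≤ ENNReal.ofReal (2 * FunctionSpaces.Torus.kineticEnergy (u₀seq m)) :=
          (hLH m).lintegral_enorm_sq_le_ofReal (hν m) (Ioo_subset_Icc_self ht)
      _ ≤ ENNReal.ofReal (2 * C) := ENNReal.ofReal_le_ofReal (by linarith [hC m])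
      _ = ((2 * C).toNNReal : ℝ≥0) := rfl
  have hm : ∀ m, AEStronglyMeasurable (FunctionSpaces.Torus.stLift (useq m))
      (volume.restrict (Ioo 0 T ×ˢ univ)) := fun m => (hLH m).weak.1
  obtain ⟨φ, hφ, u, hum, hu2, hconv⟩ :=
    FunctionSpaces.Torus.exists_strictMono_weakLimit_inner_of_lintegral_sq_le hm hb
  refine ⟨φ, hφ, u, hum, hu2, ⟨(2 * C).toNNReal, fun m => hb (φ m)⟩, fun ψ hψ => ?_⟩
  obtain ⟨hψm, hψ2⟩ := hψ.isSpaceTimeTest.aestronglyMeasurable_and_lintegral_lt_top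
  exact hconv ψ hψm hψ2

end Literature.Analysis.FluidPDE.Torus

/-! ## The discharge -/

namespace Literature.Analysis.FluidPDE

variable {d : Type*} [Fintype d] [DecidableEq d] {T : ℝ} {νseq : ℕ → ℝ}
  {useq : ℕ → ℝ → UnitAddTorus d → EuclideanSpace ℝ d}
  {u₀seq : ℕ → UnitAddTorus d → EuclideanSpace ℝ d}

/-- **turb.S20, discharged** (DiPerna–Majda 1987, §1 Theorem and §5, (5.2)–(5.3) with Prop. 5.1
— the weak-* / dissipation-measure part; Buckmaster–Vicol 2019, §8): the named fact
`tendstoWeakStar_compact` holds. Bounded-energy unforced Leray–Hopf families with `ν_m > 0` are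
bounded in `L^∞_t L²_x`, so a subsequence converges weak-* to some `u`
(`Torus.exists_strictMono_tendstoWeakStar_of_isLerayHopfOn`, Banach–Alaoglu); along a further
subsequence — which keeps the weak-* limit — the dissipation measures `ν_m|∇u_m|² dx dt` converge
weakly to a finite measure `D` (`Torus.TendstoWeakStar.exists_subseq_isDissipationMeasureOf_holds`,
Prokhorov). The hypothesis `ν_m → 0` is carried by the fact but not needed for compactness.
[cite: DiPernaMajda1987, §1 Theorem and §5, (5.2)–(5.3) with Prop. 5.1 (weak-* / dissipation-measure part only)] -/
theorem tendstoWeakStar_compact_holds :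
    tendstoWeakStar_compact (T := T) (νseq := νseq) (useq := useq) (u₀seq := u₀seq) := by
  intro hν _ hLH hE
  obtain ⟨φ, hφ, u, -, -, hconv⟩ :=
    Torus.exists_strictMono_tendstoWeakStar_of_isLerayHopfOn (fun m => (hν m).le) hLH hE
  obtain ⟨C, hC⟩ := hE
  obtain ⟨χ, hχ, hconv', D, hD⟩ :=
    Torus.TendstoWeakStar.exists_subseq_isDissipationMeasureOf_holds hconv
      (fun m => (hν (φ m)).le) (fun m => hLH (φ m)) ⟨C, fun m => hC (φ m)⟩
  exact ⟨φ ∘ χ, hφ.comp hχ, u, D, hconv', hD⟩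

end Literature.Analysis.FluidPDE
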